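import Literature.Probability.Percolation.BoxCrossingUpperBound
import Literature.Probability.Percolation.BoxCrossingJordan

/-!
# Stub `stub_boundaryArmTightness`, geometric input I: straight germs of a rectilinear boundary
# and the local side of a Jordan domain
# (line `excursion-kernel-covariance`, crux `RectilinearCardy`, stmt-CriticalPhenomena-5660)

Generic plane-geometry lemmas for the local picture of a rectilinear Jordan polygon at a boundary
point `b` (used at the junction `b = pt 1` of the arcs `(ab)` and `(b…d)` of a rectilinear conformal
rectangle):

* `exists_pos_forall_mem_cross`: if a set `F` is covered by finitely many axis-parallel segments,
  then near any point `b` it lies on the cross `{re = b.re} ∪ {im = b.im}` (the segments missing `b`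
  form a closed set missing `b`);
* `exists_dir_of_mem_cross`: a curve running on the cross through `b` and avoiding `b` on an open
  parameter interval runs on ONE of the four axis rays from `b` (connectedness);
* `exists_mem_Icc_eq_of_norm_le` / `…'`: such a straight piece ending (starting) at `b` fills an
  initial segment of its ray (intermediate value theorem);
* `carrier_inter_ball_eq_or`: if a small ball around a boundary point of a Jordan domain `D` is
  covered by the frontier and two connected sets `P₁`, `P₂` missing the frontier, then `D` fills
  exactly one of them inside the ball (both `D` and its exterior accumulate at `b` — Jordan curve
  theorem, `JordanCurveTheorem_holds`).
-/

noncomputable section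

open Set Filter Topology MeasureTheory Metric
open Literature.Probability.RandomPlanarGeometry

namespace Summit.CriticalPhenomena.CardyFormulaZ2.Cruxes.RectilinearCardy.ExcursionKernelCovariance

/-! ### Rectilinear covers: the cross through a point -/

/-- **Near any point, a set covered by finitely many axis-parallel segments lies on the cross
through that point.** If `F ⊆ ⋃_{p ∈ S} [p.1, p.2]` with every segment horizontal or vertical,
then for some `r > 0` every point of `F` within `r` of `b` has real part `b.re` or imaginary part
`b.im`: the segments missing `b` form a closed set missing `b`, and a segment through `b` lies on
the horizontal or the vertical line through `b`. [folklore] -/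
theorem exists_pos_forall_mem_cross {S : Finset (ℂ × ℂ)} {F : Set ℂ}
    (hS : ∀ p ∈ S, p.1.re = p.2.re ∨ p.1.im = p.2.im) (hF : F ⊆ ⋃ p ∈ S, segment ℝ p.1 p.2)
    (b : ℂ) : ∃ r : ℝ, 0 < r ∧ ∀ z ∈ F, dist z b < r → z.re = b.re ∨ z.im = b.im := by
  classical
  have him : ∀ {a c w : ℂ}, a.im = c.im → w ∈ segment ℝ a c → w.im = a.im := by
    rintro a c w h ⟨t₁, t₂, -, -, hsum, rfl⟩
    simp only [Complex.add_im, Complex.smul_im, smul_eq_mul]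
    linear_combination (-t₂) * h + a.im * hsum
  have hre : ∀ {a c w : ℂ}, a.re = c.re → w ∈ segment ℝ a c → w.re = a.re := by
    rintro a c w h ⟨t₁, t₂, -, -, hsum, rfl⟩
    simp only [Complex.add_re, Complex.smul_re, smul_eq_mul]
    linear_combination (-t₂) * h + a.re * hsum
  set K : Set ℂ := ⋃ p ∈ S.filter (fun p => b ∉ segment ℝ p.1 p.2), segment ℝ p.1 p.2 with hK
  have hKc : IsClosed K := by
    refine isClosed_biUnion_finset fun p _ => ?_
    rw [segment_eq_image_lineMap]
    exact (isCompact_Icc.image AffineMap.lineMap_continuous).isClosed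
  have hbK : b ∉ K := by
    intro h
    obtain ⟨p, hp, hbp⟩ := mem_iUnion₂.1 h
    exact (Finset.mem_filter.1 hp).2 hbp
  obtain ⟨r, hr, hball⟩ := Metric.mem_nhds_iff.1 (hKc.isOpen_compl.mem_nhds hbK)
  refine ⟨r, hr, fun z hz hd => ?_⟩
  obtain ⟨q, hq, hzq⟩ := mem_iUnion₂.1 (hF hz)
  have hbq : b ∈ segment ℝ q.1 q.2 := by
    by_contra hbq
    exact hball (Metric.mem_ball.2 hd) (mem_iUnion₂.2 ⟨q, Finset.mem_filter.2 ⟨hq, hbq⟩, hzq⟩)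
  rcases hS q hq with h | h
  · exact Or.inl (by rw [hre h hzq, hre h hbq])
  · exact Or.inr (by rw [him h hzq, him h hbq])

/-! ### Curves on the cross run along one ray -/

/-- A continuous real function without zeros on an open interval has constant sign there.
[folklore] -/
theorem forall_pos_or_forall_neg_of_ne_zero {f : ℝ → ℝ} {t₀ t₁ : ℝ}
    (hf : ContinuousOn f (Ioo t₀ t₁)) (hne : ∀ t ∈ Ioo t₀ t₁, f t ≠ 0) :
    (∀ t ∈ Ioo t₀ t₁, 0 < f t) ∨ (∀ t ∈ Ioo t₀ t₁, f t < 0) := by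
  by_contra h
  rw [not_or] at h
  obtain ⟨h1, h2⟩ := h
  push Not at h1 h2
  obtain ⟨t, ht, hft⟩ := h1
  obtain ⟨t', ht', hft'⟩ := h2
  have hconn : OrdConnected (f '' Ioo t₀ t₁) := (isPreconnected_Ioo.image f hf).ordConnected
  have h0 : (0 : ℝ) ∈ f '' Ioo t₀ t₁ :=
    hconn.out (mem_image_of_mem f ht) (mem_image_of_mem f ht') ⟨hft, hft'⟩
  obtain ⟨s, hs, hfs⟩ := h0
  exact hne s hs hfs

/-- **A curve on the cross through `b`, avoiding `b`, runs along one axis ray from `b`.** If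
`γ` is continuous, `γ t ≠ b` and `γ t` lies on the horizontal or vertical line through `b` for all
`t` in an open interval, then there is a direction `d ∈ {1, i, -1, -i}` with
`γ t = b + ‖γ t - b‖ d` on that interval (the horizontal and vertical pieces are relatively closed
and disjoint, and the signed coordinate has no zero). [folklore] -/
theorem exists_dir_of_mem_cross {γ : ℝ → ℂ} (hγ : Continuous γ) {b : ℂ} {t₀ t₁ : ℝ}
    (hcross : ∀ t ∈ Ioo t₀ t₁, (γ t).re = b.re ∨ (γ t).im = b.im)
    (hne : ∀ t ∈ Ioo t₀ t₁, γ t ≠ b) :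
    ∃ d : ℂ, (d = 1 ∨ d = Complex.I ∨ d = -1 ∨ d = -Complex.I) ∧
      ∀ t ∈ Ioo t₀ t₁, γ t = b + ((‖γ t - b‖ : ℝ) : ℂ) * d := by
  -- the whole interval is horizontal or the whole interval is vertical
  have hsplit : Ioo t₀ t₁ ⊆ {t | (γ t).im = b.im} ∨ Ioo t₀ t₁ ⊆ {t | (γ t).re = b.re} := by
    refine isPreconnected_iff_subset_of_disjoint_closed.1 isPreconnected_Ioo _ _
      (isClosed_eq (by fun_prop) continuous_const) (isClosed_eq (by fun_prop) continuous_const)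
      (fun t ht => (hcross t ht).symm) ?_
    ext t
    simp only [mem_inter_iff, mem_setOf_eq, mem_empty_iff_false, iff_false, not_and]
    intro ht him hre
    exact hne t ht (Complex.ext hre him)
  rcases hsplit with hH | hV
  · -- horizontal: `γ t - b` is the real number `(γ t).re - b.re`
    have hreal : ∀ t ∈ Ioo t₀ t₁, γ t - b = (((γ t).re - b.re : ℝ) : ℂ) := fun t ht => by
      have h := hH ht
      simp only [mem_setOf_eq] at h
      exact Complex.ext (by simp) (by simp [h])
    have hne' : ∀ t ∈ Ioo t₀ t₁, (γ t).re - b.re ≠ 0 := by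
      intro t ht h0
      exact hne t ht (Complex.ext (by linarith) (hH ht))
    rcases forall_pos_or_forall_neg_of_ne_zero (f := fun t => (γ t).re - b.re)
      (by fun_prop) hne' with hpos | hneg
    · refine ⟨1, Or.inl rfl, fun t ht => ?_⟩
      have hn : ‖γ t - b‖ = (γ t).re - b.re := by
        rw [hreal t ht, Complex.norm_real, Real.norm_eq_abs, abs_of_pos (hpos t ht)]
      rw [hn, mul_one, ← hreal t ht, add_sub_cancel]
    · refine ⟨-1, Or.inr (Or.inr (Or.inl rfl)), fun t ht => ?_⟩
      have hn : ‖γ t - b‖ = -((γ t).re - b.re) := by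
        rw [hreal t ht, Complex.norm_real, Real.norm_eq_abs, abs_of_neg (hneg t ht)]
      rw [hn, mul_neg_one, Complex.ofReal_neg, neg_neg, ← hreal t ht, add_sub_cancel]
  · -- vertical: `γ t - b` is `((γ t).im - b.im) i`
    have himag : ∀ t ∈ Ioo t₀ t₁, γ t - b = (((γ t).im - b.im : ℝ) : ℂ) * Complex.I :=
      fun t ht => by
      have h := hV ht
      simp only [mem_setOf_eq] at h
      exact Complex.ext (by simp [h]) (by simp)
    have hne' : ∀ t ∈ Ioo t₀ t₁, (γ t).im - b.im ≠ 0 := by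
      intro t ht h0
      exact hne t ht (Complex.ext (hV ht) (by linarith))
    rcases forall_pos_or_forall_neg_of_ne_zero (f := fun t => (γ t).im - b.im)
      (by fun_prop) hne' with hpos | hneg
    · refine ⟨Complex.I, Or.inr (Or.inl rfl), fun t ht => ?_⟩
      have hn : ‖γ t - b‖ = (γ t).im - b.im := by
        rw [himag t ht, norm_mul, Complex.norm_I, mul_one, Complex.norm_real, Real.norm_eq_abs,
          abs_of_pos (hpos t ht)]
      rw [hn, ← himag t ht, add_sub_cancel]
    · refine ⟨-Complex.I, Or.inr (Or.inr (Or.inr rfl)), fun t ht => ?_⟩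
      have hn : ‖γ t - b‖ = -((γ t).im - b.im) := by
        rw [himag t ht, norm_mul, Complex.norm_I, mul_one, Complex.norm_real, Real.norm_eq_abs,
          abs_of_neg (hneg t ht)]
      rw [hn, mul_neg, Complex.ofReal_neg, neg_mul, neg_neg, ← himag t ht, add_sub_cancel]

/-! ### A straight piece ending at `b` fills an initial segment of its ray -/

/-- **Filling (piece ending at `b`).** If `γ t = b + ‖γ t - b‖ d` on `[t₀, t₁]` and `γ t₁ = b`,
then every point `b + s d`, `0 ≤ s ≤ ‖γ t₀ - b‖`, is of the form `γ t` with `t ∈ [t₀, t₁]`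
(intermediate value theorem for `t ↦ ‖γ t - b‖`). [folklore] -/
theorem exists_mem_Icc_eq_of_norm_le {γ : ℝ → ℂ} (hγ : Continuous γ) {b d : ℂ} {t₀ t₁ : ℝ}
    (h01 : t₀ ≤ t₁) (hdir : ∀ t ∈ Icc t₀ t₁, γ t = b + ((‖γ t - b‖ : ℝ) : ℂ) * d)
    (hend : γ t₁ = b) {s : ℝ} (hs0 : 0 ≤ s) (hs : s ≤ ‖γ t₀ - b‖) :
    ∃ t ∈ Icc t₀ t₁, γ t = b + (s : ℂ) * d := by
  have hcont : ContinuousOn (fun t => ‖γ t - b‖) (Icc t₀ t₁) := by fun_prop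
  have hmem : s ∈ Icc ‖γ t₁ - b‖ ‖γ t₀ - b‖ := ⟨by rw [hend, sub_self, norm_zero]; exact hs0, hs⟩
  obtain ⟨t, ht, hts⟩ := intermediate_value_Icc' h01 hcont hmem
  refine ⟨t, ht, ?_⟩
  rw [hdir t ht]
  simp only at hts
  rw [hts]

/-- **Filling (piece starting at `b`).** If `γ t = b + ‖γ t - b‖ d` on `[t₀, t₁]` and `γ t₀ = b`,
then every point `b + s d`, `0 ≤ s ≤ ‖γ t₁ - b‖`, is of the form `γ t` with `t ∈ [t₀, t₁]`.
[folklore] -/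
theorem exists_mem_Icc_eq_of_norm_le' {γ : ℝ → ℂ} (hγ : Continuous γ) {b d : ℂ} {t₀ t₁ : ℝ}
    (h01 : t₀ ≤ t₁) (hdir : ∀ t ∈ Icc t₀ t₁, γ t = b + ((‖γ t - b‖ : ℝ) : ℂ) * d)
    (hstart : γ t₀ = b) {s : ℝ} (hs0 : 0 ≤ s) (hs : s ≤ ‖γ t₁ - b‖) :
    ∃ t ∈ Icc t₀ t₁, γ t = b + (s : ℂ) * d := by
  have hcont : ContinuousOn (fun t => ‖γ t - b‖) (Icc t₀ t₁) := by fun_prop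
  have hmem : s ∈ Icc ‖γ t₀ - b‖ ‖γ t₁ - b‖ := ⟨by rw [hstart, sub_self, norm_zero]; exact hs0, hs⟩
  obtain ⟨t, ht, hts⟩ := intermediate_value_Icc h01 hcont hmem
  refine ⟨t, ht, ?_⟩
  rw [hdir t ht]
  simp only at hts
  rw [hts]

/-! ### The local side of a Jordan domain -/

/-- **A Jordan domain fills exactly one of two local sectors.** Let `b` be a frontier point of the
Jordan domain `D` and `r > 0`. Suppose the ball `B(b, r)` is covered by the frontier of `D` and two
sets `P₁`, `P₂` which miss the frontier inside the ball and whose traces on the ball are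
preconnected. Then `D ∩ B(b, r)` is `P₁ ∩ B(b, r)` or `P₂ ∩ B(b, r)`: each trace lies in `D` or in
the exterior `(D̄)ᶜ` (it is connected and misses `∂D`), and both `D` and the exterior meet the
ball (the exterior accumulates at every boundary point by the Jordan curve theorem,
`frontier_subset_closure_exterior`). [folklore] -/
theorem carrier_inter_ball_eq_or (D : JordanDomain) {b : ℂ} (hb : b ∈ frontier D.carrier)
    {r : ℝ} {P₁ P₂ : Set ℂ} (h₁ : IsPreconnected (P₁ ∩ ball b r))
    (h₂ : IsPreconnected (P₂ ∩ ball b r))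
    (hcover : ball b r ⊆ P₁ ∪ P₂ ∪ frontier D.carrier)
    (hP₁ : ∀ z ∈ P₁, dist z b < r → z ∉ frontier D.carrier)
    (hP₂ : ∀ z ∈ P₂, dist z b < r → z ∉ frontier D.carrier) :
    D.carrier ∩ ball b r = P₁ ∩ ball b r ∨ D.carrier ∩ ball b r = P₂ ∩ ball b r := by
  set Ω := D.carrier with hΩ
  set X := (closure Ω)ᶜ with hX
  have hΩo : IsOpen Ω := D.isOpen
  have hXo : IsOpen X := isClosed_closure.isOpen_compl
  have hdisj : Disjoint Ω X :=
    Set.disjoint_left.2 fun z hz hzX => hzX (subset_closure hz)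
  -- the complement of the frontier is `Ω ∪ X`
  have hcompl : ∀ z, z ∉ frontier Ω → z ∈ Ω ∪ X := by
    intro z hz
    by_cases hzΩ : z ∈ Ω
    · exact Or.inl hzΩ
    · refine Or.inr fun hzc => hz ?_
      rw [frontier_eq_closure_inter_closure]
      exact ⟨hzc, subset_closure hzΩ⟩
  have hsub₁ : P₁ ∩ ball b r ⊆ Ω ∪ X := fun z hz => hcompl z (hP₁ z hz.1 (mem_ball.1 hz.2))
  have hsub₂ : P₂ ∩ ball b r ⊆ Ω ∪ X := fun z hz => hcompl z (hP₂ z hz.1 (mem_ball.1 hz.2))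
  have hor₁ := h₁.subset_or_subset hΩo hXo hdisj hsub₁
  have hor₂ := h₂.subset_or_subset hΩo hXo hdisj hsub₂
  -- `Ω` and `X` miss the frontier, hence lie in `P₁ ∪ P₂` inside the ball
  have hΩf : ∀ z ∈ Ω, z ∉ frontier Ω := fun z hz hzf => by
    rw [hΩo.frontier_eq] at hzf  -- frontier = closure \ Ω
    exact hzf.2 hz
  have hXf : ∀ z ∈ X, z ∉ frontier Ω := fun z hz hzf => hz (frontier_subset_closure hzf)
  have hΩsub : Ω ∩ ball b r ⊆ (P₁ ∩ ball b r) ∪ (P₂ ∩ ball b r) := by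
    rintro z ⟨hzΩ, hzb⟩
    rcases hcover hzb with (h | h) | h
    · exact Or.inl ⟨h, hzb⟩
    · exact Or.inr ⟨h, hzb⟩
    · exact absurd h (hΩf z hzΩ)
  have hXsub : X ∩ ball b r ⊆ (P₁ ∩ ball b r) ∪ (P₂ ∩ ball b r) := by
    rintro z ⟨hzX, hzb⟩
    rcases hcover hzb with (h | h) | h
    · exact Or.inl ⟨h, hzb⟩
    · exact Or.inr ⟨h, hzb⟩
    · exact absurd h (hXf z hzX)
  -- both `Ω` and `X` meet the ball
  by_cases hr : 0 < r
  swap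
  · left
    have hball : ball b r = ∅ := Metric.ball_eq_empty.2 (not_lt.1 hr)
    simp [hball]
  have hΩne : (Ω ∩ ball b r).Nonempty := by
    have : b ∈ closure Ω := frontier_subset_closure hb
    obtain ⟨z, hzΩ, hz⟩ := Metric.mem_closure_iff.1 this r hr
    exact ⟨z, hzΩ, mem_ball.2 (by rw [dist_comm]; exact hz)⟩
  have hXne : (X ∩ ball b r).Nonempty := by
    have : b ∈ closure X :=
      D.frontier_subset_closure_exterior
        Literature.Topology.PlaneTopology.JordanCurveTheorem_holds hb
    obtain ⟨z, hzX, hz⟩ := Metric.mem_closure_iff.1 this r hr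
    exact ⟨z, hzX, mem_ball.2 (by rw [dist_comm]; exact hz)⟩
  obtain ⟨zΩ, hzΩ⟩ := hΩne
  obtain ⟨zX, hzX⟩ := hXne
  rcases hor₁ with h1Ω | h1X
  · -- `P₁ ∩ ball ⊆ Ω`; then `P₂ ∩ ball ⊆ X` (it contains the exterior point `zX`)
    left
    have h2X : P₂ ∩ ball b r ⊆ X := by
      rcases hor₂ with h2Ω | h2X
      · exfalso
        rcases hXsub hzX with h | h
        · exact Set.disjoint_left.1 hdisj (h1Ω h) hzX.1
        · exact Set.disjoint_left.1 hdisj (h2Ω h) hzX.1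
      · exact h2X
    refine Subset.antisymm (fun z hz => ?_) fun z hz => ⟨h1Ω hz, hz.2⟩
    rcases hΩsub hz with h | h
    · exact h
    · exact absurd (h2X h) (Set.disjoint_left.1 hdisj hz.1)
  · right
    have h2Ω : P₂ ∩ ball b r ⊆ Ω := by
      rcases hor₂ with h2Ω | h2X
      · exact h2Ω
      · exfalso
        rcases hΩsub hzΩ with h | h
        · exact Set.disjoint_left.1 hdisj hzΩ.1 (h1X h)
        · exact Set.disjoint_left.1 hdisj hzΩ.1 (h2X h)
    refine Subset.antisymm (fun z hz => ?_) fun z hz => ⟨h2Ω hz, hz.2⟩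
    rcases hΩsub hz with h | h
    · exact absurd (h1X h) (Set.disjoint_left.1 hdisj hz.1)
    · exact h

end Summit.CriticalPhenomena.CardyFormulaZ2.Cruxes.RectilinearCardy.ExcursionKernelCovariance

end
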